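import Summits.SmoothPoincare4.SmoothPoincare4.Theorems.SymplecticOrigamiGromovRecognitionRelEndGlueDefs
import Summits.SmoothPoincare4.SmoothPoincare4.Theorems.SymplecticOrigamiGromovRecognitionRelEndGluedBasics
import Summits.SmoothPoincare4.SmoothPoincare4.Theorems.SymplecticOrigamiGromovRecognitionRelEndWindLinAlg
import Mathlib

/-!
# Generic lemmas of the joint step of the bi-foliation (aux file of the registered helper
`helper_joint` (L9) of line `cross-cap-laurent`, crux `GromovRecognitionRelEnd`,
item stmt-SmoothPoincare4-11009; registered aux helper `helper_kerEqRangeFour`)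

Kernel bookkeeping in real dimension four (`helper_kerEqRangeFour`: for `ℓ : ℝ⁴ → ℂ` onto and
`m : ℂ → ℝ⁴` injective with `ℓ ∘ m = 0`, `ker ℓ = range m` — both are real planes), the chain rule
along a curve inside the zero set of a normal witness, surjectivity of `d(π ∘ p)` versus
transversality (`helper_transverse_iff`), compactness of the image of a two-chart sphere, the swap
of a normal witness, a uniform radius for finitely many positive radii, the punctured-disc form of
`𝓝[≠]`, a closedness lemma for the point at infinity, and the integer bookkeeping "a finite sum of
terms `≥ 1` equals `1` only with exactly one term".  No new definitions.
-/

noncomputable section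

open scoped Manifold ContDiff Topology
open Set Function Filter Literature.Topology.FourManifolds Literature.Topology.FourManifolds.ComplexProjectiveSpace
  Literature.Geometry.Symplectic

-- the prescribed namespace `Summit.<P>.<Sub>.…` duplicates `SmoothPoincare4` (P = Sub)
set_option linter.dupNamespace false

namespace Summit.SmoothPoincare4.SmoothPoincare4.Theorems.GromovRecognitionRelEnd.CrossCapLaurent

/-- **Registered aux helper `helper_kerEqRangeFour`: kernel bookkeeping in real dimension four.**
For `ℓ : ℝ⁴ → ℂ` onto and `m : ℂ → ℝ⁴` injective (real-linear) with `ℓ ∘ m = 0`, every vector of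
`ker ℓ` is in `range m` (rank–nullity: both are planes). -/
theorem helper_kerEqRangeFour : ∀ (ℓ : EuclideanSpace ℝ (Fin 4) →L[ℝ] ℂ)
    (m : ℂ →L[ℝ] EuclideanSpace ℝ (Fin 4)), Surjective ℓ → Injective m →
    (∀ ζ : ℂ, ℓ (m ζ) = 0) → ∀ ξ : EuclideanSpace ℝ (Fin 4), ℓ ξ = 0 → ξ ∈ Set.range m := by
  intro ℓ m hℓ hm hcomp ξ hξ
  -- `range m ≤ ker ℓ`, both of finrank `2`, hence equal
  have hle : LinearMap.range (m : ℂ →ₗ[ℝ] EuclideanSpace ℝ (Fin 4)) ≤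
      LinearMap.ker (ℓ : EuclideanSpace ℝ (Fin 4) →ₗ[ℝ] ℂ) := by
    rintro _ ⟨ζ, rfl⟩
    exact hcomp ζ
  have hker : Module.finrank ℝ (LinearMap.ker (ℓ : EuclideanSpace ℝ (Fin 4) →ₗ[ℝ] ℂ)) = 2 := by
    have h1 := LinearMap.finrank_range_add_finrank_ker (ℓ : EuclideanSpace ℝ (Fin 4) →ₗ[ℝ] ℂ)
    have h2 : Module.finrank ℝ (LinearMap.range (ℓ : EuclideanSpace ℝ (Fin 4) →ₗ[ℝ] ℂ)) = 2 := by
      rw [LinearMap.range_eq_top.mpr hℓ, finrank_top, Complex.finrank_real_complex]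
    rw [h2, finrank_euclideanSpace, Fintype.card_fin] at h1
    omega
  have hrange : Module.finrank ℝ (LinearMap.range (m : ℂ →ₗ[ℝ] EuclideanSpace ℝ (Fin 4))) = 2 := by
    rw [LinearMap.finrank_range_of_inj hm, Complex.finrank_real_complex]
  have heq := Submodule.eq_of_le_of_finrank_eq hle (by rw [hker, hrange])
  have h : ξ ∈ LinearMap.ker (ℓ : EuclideanSpace ℝ (Fin 4) →ₗ[ℝ] ℂ) := hξ
  rw [← heq] at h
  obtain ⟨ζ, hζ⟩ := h
  exact ⟨ζ, hζ⟩

/-! ## Generic lemmas of the joint step -/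

namespace Joint

variable {X : Type} [TopologicalSpace X] [ChartedSpace (EuclideanSpace ℝ (Fin 4)) X]

/-- The image of a smooth two-chart sphere is compact (it is the range of its glued map). -/
theorem isCompact_pairImage {JX : ∀ y : X, TangentSpace (𝓡 4) y →L[ℝ] TangentSpace (𝓡 4) y}
    {u v : ℂ → X} (huv : TwoChartSphere JX u v) : IsCompact (pairImage u v) := by
  obtain ⟨F, h0, h1⟩ := helper_gluedExists X u v huv.smooth_u.continuous huv.smooth_v.continuous
    huv.compat
  rw [pairImage_eq, ← helper_gluedRange X u v F huv.compat h0 h1]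
  exact isCompact_range F.continuous

/-- A normal witness of `(u, v)` is a normal witness of the swapped pair `(v, u)` (same image). -/
theorem isNormalWitness_swap {N : Set X} {π : X → ℂ} {u v : ℂ → X} (h : IsNormalWitness N π u v)
    (himg : pairImage v u = pairImage u v) : IsNormalWitness N π v u := by
  refine ⟨h.isOpen, ?_, h.smooth, h.submersive, ?_⟩
  · rw [← pairImage_eq, himg, pairImage_eq]; exact h.image_subset
  · rw [← pairImage_eq, himg, pairImage_eq]; exact h.zeroSet_eq

omit [TopologicalSpace X] [ChartedSpace (EuclideanSpace ℝ (Fin 4)) X] in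
/-- A uniform positive lower bound for finitely many positive radii. -/
theorem exists_pos_le_of_finite {S : Set ℂ} (hS : S.Finite) (f : ℂ → ℝ) (hf : ∀ z ∈ S, 0 < f z) :
    ∃ r : ℝ, 0 < r ∧ ∀ z ∈ S, r ≤ f z := by
  induction S, hS using Set.Finite.induction_on with
  | empty => exact ⟨1, one_pos, fun z hz => hz.elim⟩
  | @insert a s _ _ ih =>
    obtain ⟨r, hr, hrs⟩ := ih fun z hz => hf z (mem_insert_of_mem _ hz)
    refine ⟨min r (f a), lt_min hr (hf a (mem_insert _ _)), fun z hz => ?_⟩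
    rcases hz with rfl | hz
    · exact min_le_right _ _
    · exact (min_le_left _ _).trans (hrs z hz)

omit [TopologicalSpace X] [ChartedSpace (EuclideanSpace ℝ (Fin 4)) X] in
/-- Kernel bookkeeping in real dimension four (`helper_kerEqRangeFour` with implicit binders). -/
theorem mem_range_of_apply_eq_zero (ℓ : EuclideanSpace ℝ (Fin 4) →L[ℝ] ℂ)
    (m : ℂ →L[ℝ] EuclideanSpace ℝ (Fin 4)) (hℓ : Surjective ℓ) (hm : Injective m)
    (hcomp : ∀ ζ : ℂ, ℓ (m ζ) = 0) {ξ : EuclideanSpace ℝ (Fin 4)} (hξ : ℓ ξ = 0) :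
    ξ ∈ range m :=
  helper_kerEqRangeFour ℓ m hℓ hm hcomp ξ hξ


/-- Chain rule along a curve inside the zero set of a witness: if `π ∘ p ≡ 0` (all `p w` in the open
`N` with `π (p w) = 0`), then `dπ_{p z}` kills the tangent directions `dp_z ζ`. -/
theorem mfderiv_apply_eq_zero_of_forall {N : Set X} {π : X → ℂ} {p : ℂ → X} (hN : IsOpen N)
    (hπ : ContMDiffOn (𝓡 4) 𝓘(ℝ, ℂ) ∞ π N) (hp : ContMDiff 𝓘(ℝ, ℂ) (𝓡 4) ∞ p)
    (hmem : ∀ w, p w ∈ N ∧ π (p w) = 0) (z ζ : ℂ) :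
    mfderiv (𝓡 4) 𝓘(ℝ, ℂ) π (p z) (mfderiv 𝓘(ℝ, ℂ) (𝓡 4) p z ζ) = 0 := by
  have hπz : MDifferentiableAt (𝓡 4) 𝓘(ℝ, ℂ) π (p z) :=
    (hπ.contMDiffAt (hN.mem_nhds (hmem z).1)).mdifferentiableAt (by simp)
  have hpz : MDifferentiableAt 𝓘(ℝ, ℂ) (𝓡 4) p z := hp.mdifferentiableAt (by simp)
  have hcomp : mfderiv 𝓘(ℝ, ℂ) 𝓘(ℝ, ℂ) (π ∘ p) z =
      (mfderiv (𝓡 4) 𝓘(ℝ, ℂ) π (p z)).comp (mfderiv 𝓘(ℝ, ℂ) (𝓡 4) p z) := mfderiv_comp z hπz hpz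
  have hzero : mfderiv 𝓘(ℝ, ℂ) 𝓘(ℝ, ℂ) (π ∘ p) z = 0 := by
    have : π ∘ p = fun _ => (0 : ℂ) := funext fun w => (hmem w).2
    rw [this]
    exact mfderiv_const
  have h := DFunLike.congr_fun hcomp ζ
  rw [hzero] at h
  exact h.symm

/-- Surjectivity of `d(π ∘ p)_z` from the chain rule and transversality of `range dp_z` to
`ker dπ_{p z}` (real dimension four). -/
theorem surjective_mfderiv_comp {N : Set X} {π : X → ℂ} {p : ℂ → X} {z : ℂ} (hN : IsOpen N)
    (hπ : ContMDiffOn (𝓡 4) 𝓘(ℝ, ℂ) ∞ π N) (hp : ContMDiff 𝓘(ℝ, ℂ) (𝓡 4) ∞ p) (hz : p z ∈ N)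
    (hsurj : Surjective (mfderiv (𝓡 4) 𝓘(ℝ, ℂ) π (p z)))
    (hinj : Injective (mfderiv 𝓘(ℝ, ℂ) (𝓡 4) p z))
    (htr : ∀ ζ : ℂ, mfderiv (𝓡 4) 𝓘(ℝ, ℂ) π (p z) (mfderiv 𝓘(ℝ, ℂ) (𝓡 4) p z ζ) = 0 → ζ = 0) :
    Surjective (mfderiv 𝓘(ℝ, ℂ) 𝓘(ℝ, ℂ) (π ∘ p) z) := by
  have hπz : MDifferentiableAt (𝓡 4) 𝓘(ℝ, ℂ) π (p z) :=
    (hπ.contMDiffAt (hN.mem_nhds hz)).mdifferentiableAt (by simp)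
  have hpz : MDifferentiableAt 𝓘(ℝ, ℂ) (𝓡 4) p z := hp.mdifferentiableAt (by simp)
  rw [mfderiv_comp z hπz hpz]
  exact (helper_transverse_iff _ _ hsurj hinj).2 htr

/-- Conversely, surjectivity of `d(π ∘ p)_z` forces `range dp_z ∩ ker dπ_{p z} = 0`. -/
theorem eq_zero_of_surjective_mfderiv_comp {N : Set X} {π : X → ℂ} {p : ℂ → X} {z : ℂ}
    (hN : IsOpen N) (hπ : ContMDiffOn (𝓡 4) 𝓘(ℝ, ℂ) ∞ π N) (hp : ContMDiff 𝓘(ℝ, ℂ) (𝓡 4) ∞ p)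
    (hz : p z ∈ N) (hsurj : Surjective (mfderiv (𝓡 4) 𝓘(ℝ, ℂ) π (p z)))
    (hinj : Injective (mfderiv 𝓘(ℝ, ℂ) (𝓡 4) p z))
    (hS : Surjective (mfderiv 𝓘(ℝ, ℂ) 𝓘(ℝ, ℂ) (π ∘ p) z)) {ζ : ℂ}
    (hζ : mfderiv (𝓡 4) 𝓘(ℝ, ℂ) π (p z) (mfderiv 𝓘(ℝ, ℂ) (𝓡 4) p z ζ) = 0) : ζ = 0 := by
  have hπz : MDifferentiableAt (𝓡 4) 𝓘(ℝ, ℂ) π (p z) :=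
    (hπ.contMDiffAt (hN.mem_nhds hz)).mdifferentiableAt (by simp)
  have hpz : MDifferentiableAt 𝓘(ℝ, ℂ) (𝓡 4) p z := hp.mdifferentiableAt (by simp)
  rw [mfderiv_comp z hπz hpz] at hS
  exact (helper_transverse_iff _ _ hsurj hinj).1 hS ζ hζ

omit [ChartedSpace (EuclideanSpace ℝ (Fin 4)) X] in
/-- A point at infinity of a chart lies in a closed set containing the rest of the chart. -/
theorem apply_zero_mem_of_isClosed {L : Set X} {v : ℂ → X} (hL : IsClosed L) (hv : Continuous v)
    (h : ∀ w : ℂ, w ≠ 0 → v w ∈ L) : v 0 ∈ L := by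
  have ht : Tendsto v (𝓝[≠] (0 : ℂ)) (𝓝 (v 0)) := (hv.tendsto 0).mono_left nhdsWithin_le_nhds
  exact hL.mem_of_tendsto ht (eventually_nhdsWithin_of_forall fun w hw => h w hw)

omit [TopologicalSpace X] [ChartedSpace (EuclideanSpace ℝ (Fin 4)) X] in
/-- A punctured closed annulus condition `0 < ‖w - z‖ ≤ r₀` holds eventually in `𝓝[≠] z`. -/
theorem eventually_nhdsNE_of_punctured {P : ℂ → Prop} {z : ℂ} {r₀ : ℝ} (hr₀ : 0 < r₀)
    (h : ∀ w : ℂ, 0 < ‖w - z‖ → ‖w - z‖ ≤ r₀ → P w) : ∀ᶠ w in 𝓝[≠] z, P w := by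
  rw [eventually_nhdsWithin_iff]
  filter_upwards [Metric.ball_mem_nhds z hr₀] with w hw hne
  exact h w (norm_pos_iff.mpr (sub_ne_zero.mpr hne)) (le_of_lt (by rwa [← dist_eq_norm]))

omit [TopologicalSpace X] [ChartedSpace (EuclideanSpace ℝ (Fin 4)) X] in
/-- Integer bookkeeping of the joint step: a finite sum of terms `≥ 1` plus an optional term
`≥ 1` equals `1` only with exactly one term, equal to `1`. -/
theorem sum_eq_one_structure {s : Finset ℂ} {f : ℂ → ℤ} {b : ℤ} {P : Prop} [Decidable P]
    (hf : ∀ z ∈ s, 1 ≤ f z) (hb : P → 1 ≤ b) (h : s.sum f + (if P then b else 0) = 1) :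
    (∃ z₀, s = {z₀} ∧ f z₀ = 1 ∧ ¬ P) ∨ (s = ∅ ∧ P ∧ b = 1) := by
  have hs : (s.card : ℤ) ≤ s.sum f := by
    have := Finset.card_nsmul_le_sum s f 1 hf
    simpa using this
  by_cases hP : P
  · rw [if_pos hP] at h
    have hb1 := hb hP
    have hcard : s.card = 0 := by omega
    rw [Finset.card_eq_zero] at hcard
    subst hcard
    rw [Finset.sum_empty] at h
    exact Or.inr ⟨rfl, hP, by omega⟩
  · rw [if_neg hP, add_zero] at h
    have hcard : s.card ≤ 1 := by omega
    rcases Nat.le_one_iff_eq_zero_or_eq_one.mp hcard with h0 | h1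
    · rw [Finset.card_eq_zero] at h0
      subst h0
      simp at h
    · obtain ⟨z₀, rfl⟩ := Finset.card_eq_one.mp h1
      rw [Finset.sum_singleton] at h
      exact Or.inl ⟨z₀, rfl, h, hP⟩

end Joint

end Summit.SmoothPoincare4.SmoothPoincare4.Theorems.GromovRecognitionRelEnd.CrossCapLaurent

end
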